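import Summits.CriticalPhenomena.CardyFormulaZ2.Theorems.CardyMagicRigidityMarkovCascadeDefs
import Literature.Probability.Percolation.LoopRepresentationProofs
import Literature.Probability.Percolation.SiteInterfaceReverse
import Literature.Probability.Percolation.SiteInterfaceWindingSigns
import Literature.Probability.Percolation.TriHexLemma
import Literature.Probability.Percolation.RSW
import HarnessLib

/-!
# Colour flip on `𝕋` = loop reversal + type swap (crux `NestingRigidity`, line `markov-cascade-one-generation`)

Stub `mem_siteLoopConfig_compl_iff` of the checked skeleton
`Cruxes/NestingRigidity/Lines/markov-cascade-one-generation.lean` (crux stmt-CriticalPhenomena-4835,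
route `CardyMagicRigidity`): a lattice input of the Markov-cascade bookkeeping, no crux content.

For the typed full-plane loop configuration `siteLoopConfig δ ω` of site percolation on `δ𝕋`
(`Literature.Probability.Percolation.siteLoopConfig`: `F i` = unbased polyline loops of the honeycomb
interface loops `γ` of `ω`, type `1` iff the shoelace sum of the visited hexagon centres is positive),
the colour flip `ω ↦ ωᶜ` acts as **reversal of every member together with the type swap `i ↦ 1 - i`**:

* an interface loop of `ωᶜ` is the reverse of an interface loop of `ω`
  (`IsSiteInterfaceLoop.reverse_compl`, `SiteInterfaceReverse.lean`);
* reversing the walk reverses the vertex list, hence negates the shoelace sum (`shoelace_reverse`),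
  and that sum is never `0` on an interface loop (`IsSiteInterfaceLoop.shoelace_ne_zero`), so type `i`
  becomes type `1 - i`;
* the polyline of the reversed vertex list is the time reversal of the polyline modulo
  reparametrisation (`reparamDist_polyline_reverse`), so the unbased loop of `γ.reverse` is
  `UnbasedLoop.reverse` of the unbased loop of `γ`.

Also recorded (wanted by the next wave of the line): the law-level colour symmetry
`PT.map compl = PT` of critical site percolation (`sitePercolation_map_compl` at `p = 1/2`).

Adapted from the standing adversary's record `Cruxes/LoopLimitZ2EqT/Disproof.lean`, §4
(`siteLoopConfig_compl_F`), which is not importable from `Theorems/`.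
-/

noncomputable section

open MeasureTheory Set Filter
open scoped Topology BigOperators ENNReal Real

namespace Summit.CriticalPhenomena.CardyFormulaZ2.Cruxes.NestingRigidity.MarkovCascadeOneGeneration

open Literature.Probability.RandomPlanarGeometry Literature.Probability.Percolation
  Literature.Probability.LatticeModels
open Summit.CriticalPhenomena.CardyFormulaZ2.Theses.CardyMagicRigidity

/-! ### Reversal of honeycomb walks at the level of curve classes and unbased loops -/

/-- Reversing the vertex list reverses the polyline class: the polyline through `l.reverse` is the
time reversal of the polyline through `l` modulo reparametrisation (`reparamDist_polyline_reverse`).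
[folklore] -/
theorem curveClassMk_polyline_reverse (l : List ℂ) :
    CurveClass.mk (⟨polyline l.reverse⟩ : Curve ℂ) = (CurveClass.mk (⟨polyline l⟩ : Curve ℂ)).reverse := by
  rw [CurveClass.reverse_mk]
  exact CurveClass.mk_eq_mk.2 (reparamDist_polyline_reverse l)

/-- The curve class of the reversed closed honeycomb walk is the time reversal of the curve class of
the walk. [folklore] -/
theorem siteLoopCurve_reverse (δ : ℝ) {v : HexVertex} (γ : hexGraph.Walk v v) :
    siteLoopCurve δ γ.reverse = (siteLoopCurve δ γ).reverse := by
  unfold siteLoopCurve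
  rw [SimpleGraph.Walk.toCurve, SimpleGraph.Walk.toCurve, SimpleGraph.Walk.support_reverse,
    List.map_reverse]
  exact curveClassMk_polyline_reverse _

/-- **Geometric identity**: the unbased loop of the reversed walk is the reversed unbased loop.
[folklore] -/
theorem unbasedLoopMk_siteLoopCurve_reverse (δ : ℝ) {v : HexVertex} (γ : hexGraph.Walk v v) :
    UnbasedLoop.mk (BasedLoop.mk (siteLoopCurve δ γ.reverse) (isLoop_siteLoopCurve δ γ.reverse)) =
      (UnbasedLoop.mk (BasedLoop.mk (siteLoopCurve δ γ) (isLoop_siteLoopCurve δ γ))).reverse := by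
  rw [UnbasedLoop.reverse_mk]
  congr 1
  exact Subtype.ext (siteLoopCurve_reverse δ γ)

/-- The shoelace sum of the hexagon centres visited by the reversed walk is the opposite of that of
the walk. [folklore] -/
theorem shoelace_support_reverse {v : HexVertex} (γ : hexGraph.Walk v v) :
    shoelace (γ.reverse.support.map hexCenter) = -shoelace (γ.support.map hexCenter) := by
  rw [SimpleGraph.Walk.support_reverse, List.map_reverse, shoelace_reverse]

/-- Type bookkeeping on `Fin 2`: for a non-zero real `s`, "type `i` is `1` iff `0 < s`" is the same
as "type `1 - i` is `1` iff `0 < -s`". [folklore] -/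
theorem type_iff_sub_type_iff {s : ℝ} (hs : s ≠ 0) (i : Fin 2) :
    (i = 1 ↔ 0 < s) ↔ (1 - i = 1 ↔ 0 < -s) := by
  rcases lt_or_gt_of_ne hs with h | h
  · have h1 : 0 < -s := neg_pos.2 h
    have h2 : ¬ 0 < s := not_lt.2 h.le
    fin_cases i <;> simp [h1, h2]
  · have h1 : ¬ 0 < -s := not_lt.2 (neg_nonpos.2 h.le)
    fin_cases i <;> simp [h1, h]

/-! ### The stub: colour flip = reversal + type swap, member by member -/

/-- **Colour flip on `𝕋` = loop reversal + type swap.** A loop `u` is a type-`i` member of the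
typed configuration of the complement `ωᶜ` iff its time reversal `u.reverse` is a type-`(1 - i)`
member of the typed configuration of `ω`: an interface loop of `ωᶜ` is the reverse of an interface
loop of `ω` (`IsSiteInterfaceLoop.reverse_compl`), reversal negates the shoelace sum
(`shoelace_reverse`), which is never `0` on interface loops (`IsSiteInterfaceLoop.shoelace_ne_zero`),
and the polyline loop of the reversed walk is the reversed polyline loop
(`unbasedLoopMk_siteLoopCurve_reverse`). [folklore] -/
theorem mem_siteLoopConfig_compl_iff : ∀ (δ : ℝ) (ω : SiteConfig (Site 2)) (i : Fin 2) (u : UnbasedLoop ℂ), u ∈ (siteLoopConfig δ ωᶜ).F i ↔ u.reverse ∈ (siteLoopConfig δ ω).F (1 - i) := by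
  intro δ ω i u
  simp only [mem_siteLoopConfig_iff]
  constructor
  · rintro ⟨v, γ, hγ, ht, rfl⟩
    have hγ' : IsSiteInterfaceLoop ω γ.reverse := by
      have := hγ.reverse_compl
      rwa [compl_compl] at this
    have hne : shoelace (γ.support.map hexCenter) ≠ 0 := hγ.shoelace_ne_zero one_pos
    refine ⟨v, γ.reverse, hγ', ?_, (unbasedLoopMk_siteLoopCurve_reverse δ γ).symm⟩
    rw [shoelace_support_reverse]
    exact (type_iff_sub_type_iff hne i).1 ht
  · rintro ⟨v, γ, hγ, ht, hu⟩
    have hne : shoelace (γ.support.map hexCenter) ≠ 0 := hγ.shoelace_ne_zero one_pos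
    refine ⟨v, γ.reverse, hγ.reverse_compl, ?_, ?_⟩
    · rw [shoelace_support_reverse]
      have := (type_iff_sub_type_iff hne (1 - i)).1 ht
      rwa [sub_sub_cancel] at this
    · rw [unbasedLoopMk_siteLoopCurve_reverse, ← hu, UnbasedLoop.reverse_reverse]

/-! ### Law-level colour symmetry of critical site percolation -/

/-- **`P_{1/2}` on `𝕋` is invariant under the colour flip `ω ↦ ωᶜ`**: the law of the complement
configuration under `P_p` is `P_{1-p}` (`sitePercolation_map_compl`) and `1 - 1/2 = 1/2`. [folklore] -/
theorem PT_map_compl : PT.map compl = PT := by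
  show (sitePercolation (Site 2) half).map compl = sitePercolation (Site 2) half
  rw [sitePercolation_map_compl, symm_half]

end Summit.CriticalPhenomena.CardyFormulaZ2.Cruxes.NestingRigidity.MarkovCascadeOneGeneration

end
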